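import Summits.BirchSwinnertonDyer.Rank1Residual.X11b.AnticyclotomicLocalTowerTorsion
import Summits.BirchSwinnertonDyer.BirchSwinnertonDyer.Theorems.SchneiderFreeAdditiveX3AnticyclotomicTorsionLayers
import Summits.BirchSwinnertonDyer.BirchSwinnertonDyer.Theorems.SchneiderFreeControlAtoms
import HarnessLib

/-!
# Fin_v reduced to the canonical line: the local tower torsion lies in any `D_𝔭`-stable subgroup
# modulo which some element of `D_𝔭` acts as `−1`

Seat `bsd-schneider-door-c5` (cell `bsd-schneider-ideate`), gen 5; route `SchneiderFreeAdditiveX3`, crux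
r5 `LocalTowerTorsionFiniteX3` (stmt-BirchSwinnertonDyer-19546; skeleton «by cell» 77a2917f: stubs
`stub_finV_potMult`, `stub_finV_gordTwo`).  The crux asks for Fin_v — finiteness of
`E(K̄)[p^∞]^{D_𝔭 ⊓ ker κ}` (the `p`-primary torsion of `E` over the completion `K_{∞,w}` of the
anticyclotomic tower at the place above `𝔭` cut out by the tree's chosen prime) — on the door's cells
(M) and (G-ord, `e = 2`); its open content is the `(3, e = 2)` frames with local `3`-torsion, where JSW17's
inertia-torsion argument (Prop. 3.3.4 Case 3(b)) does not bite.

This file is the **kernel form of the reduction of Fin_v to the canonical line**, for ANY `ℤ_p`-extension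
`κ`, any closed `D ≤ Γ_K` (e.g. `D = D_𝔭 = GreenbergSelmer.decomp 𝔭`), any odd `p`:

* §1 `mem_of_fixed_inf_kerSubgroup_of_neg` — **the tower torsion lies in the line.**  If `C ≤ M` is a
  subgroup of a discrete `p`-primary `Γ_K`-module (`p` odd, continuous orbit maps) and some `τ ∈ D`
  with `τ C ⊆ C` acts as `−1` on `M ⧸ C` (`τ m + m ∈ C` for all `m`), then every `m ∈ M` fixed by
  `N = D ⊓ ker κ` lies in `C`.  Proof: the set `V = {g | g m − m ∈ C}` is open and contains `N`, so by
  compactness (`⋂ₙ κ⁻¹(pⁿℤ_p) = ker κ`) it contains `D ⊓ κ⁻¹(pⁿ ℤ_p)` for some `n`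
  (`exists_layerSubgroup_inf_subset`), in particular `τ^{pⁿ}`; but `τ^{pⁿ} m ≡ (−1)^{pⁿ} m = −m
  (mod C)`, so `2m ∈ C`, and `m` is `p`-power torsion with `p` odd.  At a semistable-twist prime of the
  door this `C` is the canonical subgroup `C₀ = ψ ⊗ Ê♭[p^∞]` (resp. the Tate line `ψ ⊗ μ_{p^∞}`) and `τ`
  any inertia element with `ψ(τ) = −1` (`ψ` the RAMIFIED quadratic character of the semistabilising
  field — this is where `e = 2` enters): the whole tower torsion is carried by the canonical line.
* §2 `le_or_finite_of_card_layer_le` / `finite_fixed_inf_kerSubgroup_of_line` — **dichotomy.**  If moreover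
  `#C[p] ≤ p` (one cyclic layer, e.g. `C ≅ ℚ_p/ℤ_p`) then EITHER `N` fixes `C` pointwise OR the
  `N`-fixed points of `M` are finite (an infinite subgroup of a group with cyclic layers `C[pʲ]` of order
  `≤ pʲ` contains every layer).  Hence Fin_v ⟸ "some `g ∈ D_𝔭 ⊓ ker κ` moves some point of `C₀`", i.e.
  ⟸ the canonical character `β₀ = ψ·ε·unr(α)⁻¹` of `C₀` does NOT kill `D_𝔭 ⊓ ker κ` — the exact residual
  input (class field theory of `K^{ac}` at the split prime + the weight of `α`; see the seat's NOTES and the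
  FINDING memo on the item), isolated here as the hypothesis `hmove`.
* §3 the curve: `WeierstrassCurve.geomPrimaryTorsion_fixed_le_line`,
  `WeierstrassCurve.localTowerTorsionFiniteAt_of_line` (conclusion = the route's predicate
  `SchneiderFreeControlAtoms.LocalTowerTorsionFiniteAt E p κ 𝔭`, i.e. the unfolded `Set.Finite` form of
  the crux at one frame), `WeierstrassCurve.line_le_fixed_or_localTowerTorsionFiniteAt`.

Proofs only (no definition, no named fact, no `sorry`); closes nothing by itself (helper `--supports
stmt-BirchSwinnertonDyer-19546`); BSD is not advanced by any of this.

## References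

* [JetchevSkinnerWan2017] D. Jetchev, C. Skinner, X. Wan, *The Birch and Swinnerton-Dyer formula for
  elliptic curves of analytic rank one*, Camb. J. Math. 5 (2017), §3.3 Prop. 3.3.4 Case 3(b) and
  Remark 3.3.5 (arXiv:1512.06894 p. 13: "`#T^∨_{P_v}` is finite … the only place where (HT) is invoked").
* [GreenbergLNM1716] R. Greenberg, *Iwasawa theory for elliptic curves*, LNM 1716 (1999), §3 Lemma 3.3
  (p. 87), proof of Prop. 4.8 (p. 109: the pro-`p` fixed-point principle).
* [Washington1997] L. C. Washington, *Introduction to Cyclotomic Fields*, §13.1 (layers of a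
  `ℤ_p`-extension).
-/

noncomputable section

open scoped Classical

namespace Summit.BirchSwinnertonDyer.BirchSwinnertonDyer.Theorems.SchneiderFreeAdditiveX3

open NumberField IsDedekindDomain Field WeierstrassCurve
  Literature.NumberTheory.EllipticCurves Literature.NumberTheory.EllipticCurves.GreenbergSelmer
  Literature.NumberTheory.GaloisRepresentations
  Summit.BirchSwinnertonDyer.Rank1Residual.X11b

set_option linter.dupNamespace false

variable {K : Type} [Field K] [NumberField K] {p : ℕ} [hp : Fact p.Prime] (κ : ZpExtension K p)

/-! ## §1. The tower torsion lies in the line -/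

section Generic

variable {M : Type} [AddCommGroup M] [DistribMulAction (absoluteGaloisGroup K) M]
  [TopologicalSpace M] [DiscreteTopology M]

/-- **Compactness along the layers.** For `D ≤ Γ_K` closed and an open set `V ⊆ Γ_K` containing
`N = D ⊓ ker κ`, some layer `D ⊓ κ⁻¹(pⁿ ℤ_p)` lies in `V`: the closed sets `(D ∩ κ⁻¹(pⁿℤ_p)) ∖ V`
decrease to `(D ∩ ker κ) ∖ V = ∅` in the compact group `Γ_K` (`⋂ₙ κ⁻¹(pⁿ ℤ_p) = ker κ`).
[cite: Washington1997, §13.1] -/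
theorem exists_layerSubgroup_inf_subset (D : Subgroup (absoluteGaloisGroup K))
    (hD : IsClosed (D : Set (absoluteGaloisGroup K))) {V : Set (absoluteGaloisGroup K)}
    (hV : IsOpen V) (hN : ∀ g ∈ D ⊓ κ.kerSubgroup, g ∈ V) :
    ∃ n : ℕ, ∀ g ∈ D ⊓ κ.layerSubgroup n, g ∈ V := by
  set F : ℕ → Set (absoluteGaloisGroup K) := fun n ↦ (κ.layerSubgroup n : Set _) ∩ Vᶜ with hF
  have hFclosed : ∀ n, IsClosed (F n) := fun n ↦
    ((κ.layerSubgroup n).isClosed_of_isOpen (κ.isOpen_layerSubgroup n)).inter hV.isClosed_compl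
  have hFdir : Directed (· ⊇ ·) F := fun i j ↦ ⟨max i j,
    Set.inter_subset_inter_left _ (κ.layerSubgroup_antitone (le_max_left i j)),
    Set.inter_subset_inter_left _ (κ.layerSubgroup_antitone (le_max_right i j))⟩
  have hempty : (D : Set (absoluteGaloisGroup K)) ∩ ⋂ n, F n = ∅ := by
    rw [Set.eq_empty_iff_forall_notMem]
    rintro g ⟨hgD, hgF⟩
    rw [Set.mem_iInter] at hgF
    have hgker : g ∈ κ.kerSubgroup :=
      AcSelmer.mem_kerSubgroup_of_forall_mem_layerSubgroup κ fun n ↦ (hgF n).1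
    exact (hgF 0).2 (hN g (Subgroup.mem_inf.mpr ⟨hgD, hgker⟩))
  obtain ⟨n, hn⟩ := hD.isCompact.elim_directed_family_closed F hFclosed hempty hFdir
  refine ⟨n, fun g hg ↦ ?_⟩
  obtain ⟨hgD, hgL⟩ := Subgroup.mem_inf.mp hg
  by_contra hgV
  have : g ∈ (D : Set (absoluteGaloisGroup K)) ∩ F n := ⟨hgD, hgL, hgV⟩
  rw [hn] at this
  exact this

omit [NumberField K] hp [TopologicalSpace M] [DiscreteTopology M] in
/-- If `τ` preserves `C` and acts as `−1` on `M ⧸ C`, then `τ^k` acts as `(−1)^k` on `M ⧸ C`: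
`τ^k m − (−1)^k m ∈ C`. [folklore] -/
theorem pow_smul_sub_neg_one_pow_smul_mem (C : AddSubgroup M) {τ : absoluteGaloisGroup K}
    (hτC : ∀ c ∈ C, τ • c ∈ C) (hτ : ∀ m : M, τ • m + m ∈ C) (m : M) (k : ℕ) :
    τ ^ k • m - ((-1 : ℤ) ^ k) • m ∈ C := by
  induction k with
  | zero => simp [C.zero_mem]
  | succ k ih =>
    have h1 : τ • (τ ^ k • m - ((-1 : ℤ) ^ k) • m) ∈ C := hτC _ ih
    have h2 : ((-1 : ℤ) ^ k) • (τ • m + m) ∈ C := C.zsmul_mem (hτ m) _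
    have key : τ ^ (k + 1) • m - ((-1 : ℤ) ^ (k + 1)) • m =
        τ • (τ ^ k • m - ((-1 : ℤ) ^ k) • m) + ((-1 : ℤ) ^ k) • (τ • m + m) := by
      rw [pow_succ', mul_smul, smul_sub, smul_comm τ ((-1 : ℤ) ^ k) m, smul_add, pow_succ,
        mul_neg_one, neg_smul]
      abel
    rw [key]
    exact C.add_mem h1 h2

omit [NumberField K] hp [DistribMulAction (absoluteGaloisGroup K) M] [TopologicalSpace M]
  [DiscreteTopology M] in
/-- `2m ∈ C` and `p^k m = 0` with `p` odd give `m ∈ C` (`p^k = 2r + 1`). [folklore] -/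
theorem mem_of_two_smul_mem_of_odd (C : AddSubgroup M) (hodd : Odd p) {m : M} {k : ℕ}
    (h2 : (2 : ℕ) • m ∈ C) (hk : p ^ k • m = 0) : m ∈ C := by
  obtain ⟨r, hr⟩ := hodd.pow (n := k)
  have h1 : (r * 2) • m + m = 0 := by
    rwa [hr, mul_comm 2 r, add_nsmul, one_nsmul] at hk
  have hm : m = -(r • ((2 : ℕ) • m)) := by
    rw [smul_smul, eq_neg_iff_add_eq_zero, add_comm]
    exact h1
  rw [hm]
  exact C.neg_mem (C.nsmul_mem h2 r)

/-- **The tower torsion lies in the line.**  `Γ_K` compact, `M` a discrete `p`-primary `Γ_K`-module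
with continuous orbit maps, `p` odd; `D ≤ Γ_K` closed, `N = D ⊓ ker κ`; `C ≤ M` a subgroup preserved by
some `τ ∈ D` which acts as `−1` on `M ⧸ C` (`τ m + m ∈ C` for every `m`).  Then **every `N`-fixed
`m ∈ M` lies in `C`**: the open set `{g | g m − m ∈ C}` contains `N`, hence a layer `D ⊓ κ⁻¹(pⁿ ℤ_p)`
(`exists_layerSubgroup_inf_subset`), hence `τ^{pⁿ}`; so `τ^{pⁿ} m − m ∈ C` while
`τ^{pⁿ} m + m ∈ C` (`pⁿ` odd), whence `2m ∈ C` and `m ∈ C`.  (For `D = D_𝔭` at a semistable-twist prime,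
`C = C₀` the canonical subgroup and `τ` an inertia element on which the ramified quadratic character is
`−1`: `E(K_{∞,w})[p^∞] ⊆ C₀`.) [cite: GreenbergLNM1716, §3 Lemma 3.3 (p. 87) and proof of Prop. 4.8 (p. 109)] -/
theorem mem_of_fixed_inf_kerSubgroup_of_neg (D : Subgroup (absoluteGaloisGroup K))
    (hD : IsClosed (D : Set (absoluteGaloisGroup K)))
    (hcont : ∀ m : M, Continuous fun g : absoluteGaloisGroup K ↦ g • m)
    (htor : ∀ m : M, ∃ k : ℕ, p ^ k • m = 0) (hodd : p ≠ 2)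
    (C : AddSubgroup M) {τ : absoluteGaloisGroup K} (hτD : τ ∈ D) (hτC : ∀ c ∈ C, τ • c ∈ C)
    (hτ : ∀ m : M, τ • m + m ∈ C)
    {m : M} (hm : ∀ g ∈ D ⊓ κ.kerSubgroup, g • m = m) : m ∈ C := by
  have hodd' : Odd p := hp.out.odd_of_ne_two hodd
  -- the open "stabiliser of the class of `m`"
  set V : Set (absoluteGaloisGroup K) := (fun g : absoluteGaloisGroup K ↦ g • m) ⁻¹'
    {x : M | x - m ∈ C} with hVdef
  have hV : IsOpen V := (isOpen_discrete _).preimage (hcont m)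
  have hN : ∀ g ∈ D ⊓ κ.kerSubgroup, g ∈ V := fun g hg ↦ by
    change g • m - m ∈ C
    rw [hm g hg, sub_self]
    exact C.zero_mem
  obtain ⟨n, hn⟩ := exists_layerSubgroup_inf_subset κ D hD hV hN
  have hτn : τ ^ p ^ n ∈ D ⊓ κ.layerSubgroup n :=
    Subgroup.mem_inf.mpr ⟨D.pow_mem hτD _, AcSelmer.pow_prime_pow_mem_layerSubgroup κ τ n⟩
  have h1 : τ ^ p ^ n • m - m ∈ C := hn _ hτn
  have h2 : τ ^ p ^ n • m + m ∈ C := by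
    have h := pow_smul_sub_neg_one_pow_smul_mem C hτC hτ m (p ^ n)
    rwa [(hodd'.pow (n := n)).neg_one_pow, neg_smul, one_smul, sub_neg_eq_add] at h
  have h3 : (2 : ℕ) • m ∈ C := by
    have h := C.sub_mem h2 h1
    rwa [add_sub_sub_cancel, ← two_nsmul] at h
  obtain ⟨k, hk⟩ := htor m
  exact mem_of_two_smul_mem_of_odd C hodd' h3 hk

/-! ## §2. Dichotomy: the line is fixed pointwise, or the fixed points are finite -/

omit [NumberField K] hp [DistribMulAction (absoluteGaloisGroup K) M] [TopologicalSpace M]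
  [DiscreteTopology M] in
/-- In a `p`-primary group, an element not killed by `p^j` has a multiple of order exactly
`p^(j+1)`… precisely: if `p^k x = 0` and `p^j x ≠ 0` then some multiple `y = p^i x` has
`p^(j+1) y = 0` and `p^j y ≠ 0`. [folklore] -/
theorem exists_nsmul_order_layer {x : M} {k j : ℕ} (hk : p ^ k • x = 0) (hj : p ^ j • x ≠ 0) :
    ∃ i : ℕ, p ^ (j + 1) • (p ^ i • x) = 0 ∧ p ^ j • (p ^ i • x) ≠ 0 := by
  classical
  -- the least `k₀` with `p^{k₀} x = 0`; then `j < k₀`, take `i = k₀ - (j+1)`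
  have hex : ∃ k₀, p ^ k₀ • x = 0 := ⟨k, hk⟩
  set k₀ := Nat.find hex with hk₀def
  have hk₀ : p ^ k₀ • x = 0 := Nat.find_spec hex
  have hjk : j < k₀ := by
    by_contra h
    push Not at h
    apply hj
    obtain ⟨d, hd⟩ := Nat.exists_eq_add_of_le h
    rw [hd, pow_add, mul_comm, mul_smul, hk₀, smul_zero]
  refine ⟨k₀ - (j + 1), ?_, ?_⟩
  · rw [smul_smul, ← pow_add, show j + 1 + (k₀ - (j + 1)) = k₀ by omega, hk₀]
  · intro h
    rw [smul_smul, ← pow_add] at h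
    have hlt : j + (k₀ - (j + 1)) < k₀ := by omega
    exact Nat.find_min hex hlt h

omit [NumberField K] [TopologicalSpace M] [DiscreteTopology M] in
/-- **Dichotomy for a line with one cyclic layer.**  Let `C ≤ M` be a subgroup of a `p`-primary abelian
group with finite layers `M[p^k]` and `#C[p] ≤ p`, and `B ≤ C` a subgroup.  Then either `B` is finite or
`B = C` (indeed `C ≤ B`): if `B` is infinite it has elements of every order `p^j`, the cyclic group they
generate has order `p^j = #C[p^j]` (`card_layer_le_pow`), so `B ⊇ C[p^j]` for every `j`. [folklore] -/
theorem le_or_finite_of_card_layer_le (C B : AddSubgroup M) (hBC : B ≤ C)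
    (htor : ∀ m : M, ∃ k : ℕ, p ^ k • m = 0)
    (hfin : ∀ k : ℕ, Set.Finite {m : M | p ^ k • m = 0})
    (hC1 : Set.ncard {c : M | c ∈ C ∧ p • c = 0} ≤ p) :
    C ≤ B ∨ (B : Set M).Finite := by
  classical
  by_cases hBfin : (B : Set M).Finite
  · exact Or.inr hBfin
  left
  -- the layers `V n = C[p^n]` as subgroups
  let V : ℕ → AddSubgroup M := fun n ↦
    { carrier := {x | x ∈ C ∧ p ^ n • x = 0}
      add_mem' := by
        rintro a b ⟨haC, ha⟩ ⟨hbC, hb⟩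
        exact ⟨C.add_mem haC hbC, by rw [smul_add, ha, hb, add_zero]⟩
      zero_mem' := ⟨C.zero_mem, smul_zero _⟩
      neg_mem' := by
        rintro a ⟨haC, ha⟩
        exact ⟨C.neg_mem haC, by rw [smul_neg, ha, neg_zero]⟩ }
  have hV : ∀ n x, x ∈ V n ↔ x ∈ C ∧ p ^ n • x = 0 := fun n x ↦ Iff.rfl
  have hVfin : ∀ n, Finite (V n) := fun n ↦
    Set.finite_coe_iff.mpr ((hfin n).subset fun x hx ↦ ((hV n x).mp hx).2)
  have hV1 : Nat.card (V 1) ≤ p := by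
    have hset : ((V 1 : AddSubgroup M) : Set M) = {c : M | c ∈ C ∧ p • c = 0} := by
      ext x
      rw [SetLike.mem_coe, hV, pow_one]
      rfl
    rw [← hset, ← Nat.card_coe_set_eq] at hC1
    exact hC1
  have hcardV : ∀ n, Nat.card (V n) ≤ p ^ n := card_layer_le_pow hV hVfin hV1
  -- every layer `C[p^j]` lies in `B`
  have hlayer : ∀ j, V j ≤ B := by
    intro j
    rcases j with _ | j
    · intro x hx
      have h0 := ((hV 0 x).mp hx).2
      rw [pow_zero, one_smul] at h0
      rw [h0]; exact B.zero_mem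
    -- an element of `B` of order exactly `p^(j+1)`
    have hexb : ∃ b ∈ B, p ^ j • b ≠ 0 := by
      by_contra h
      push Not at h
      exact hBfin ((hfin j).subset fun b hb ↦ h b hb)
    obtain ⟨b, hbB, hbj⟩ := hexb
    obtain ⟨k, hk⟩ := htor b
    obtain ⟨i, hy1, hy0⟩ := exists_nsmul_order_layer (p := p) hk hbj
    set y := p ^ i • b with hydef
    have hyB : y ∈ B := B.nsmul_mem hbB _
    have hord : addOrderOf y = p ^ (j + 1) := addOrderOf_eq_prime_pow hy0 hy1
    haveI := hVfin (j + 1)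
    have hzle : AddSubgroup.zmultiples y ≤ V (j + 1) := by
      rw [AddSubgroup.zmultiples_le]
      exact ⟨hBC hyB, hy1⟩
    have hcardz : Nat.card (AddSubgroup.zmultiples y) = p ^ (j + 1) := by
      rw [Nat.card_zmultiples, hord]
    have heq : AddSubgroup.zmultiples y = V (j + 1) := by
      refine AddSubgroup.eq_of_le_of_card_ge hzle ?_
      rw [hcardz]
      exact hcardV (j + 1)
    rw [← heq, AddSubgroup.zmultiples_le]
    exact hyB
  intro c hc
  obtain ⟨k, hk⟩ := htor c
  exact hlayer k ⟨hc, hk⟩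

/-- **Fin_v reduced to the line (generic form).**  In the situation of
`mem_of_fixed_inf_kerSubgroup_of_neg` (so that the `N`-fixed points lie in `C`), if `#C[p] ≤ p` and
some `g ∈ N = D ⊓ ker κ` moves some point of `C`, then the `N`-fixed points of `M` are finite.
[cite: GreenbergLNM1716, §3 Lemma 3.3 (p. 87)] -/
theorem finite_fixed_inf_kerSubgroup_of_line (D : Subgroup (absoluteGaloisGroup K))
    (hD : IsClosed (D : Set (absoluteGaloisGroup K)))
    (hcont : ∀ m : M, Continuous fun g : absoluteGaloisGroup K ↦ g • m)
    (htor : ∀ m : M, ∃ k : ℕ, p ^ k • m = 0)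
    (hfin : ∀ k : ℕ, Set.Finite {m : M | p ^ k • m = 0}) (hodd : p ≠ 2)
    (C : AddSubgroup M) {τ : absoluteGaloisGroup K} (hτD : τ ∈ D) (hτC : ∀ c ∈ C, τ • c ∈ C)
    (hτ : ∀ m : M, τ • m + m ∈ C)
    (hC1 : Set.ncard {c : M | c ∈ C ∧ p • c = 0} ≤ p)
    (hmove : ∃ g ∈ D ⊓ κ.kerSubgroup, ∃ c ∈ C, g • c ≠ c) :
    Set.Finite {m : M | ∀ g ∈ D ⊓ κ.kerSubgroup, g • m = m} := by
  -- the fixed points as a subgroup `B ≤ C`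
  let B : AddSubgroup M :=
    { carrier := {m | ∀ g ∈ D ⊓ κ.kerSubgroup, g • m = m}
      add_mem' := fun {a b} ha hb g hg ↦ by rw [smul_add, ha g hg, hb g hg]
      zero_mem' := fun g _ ↦ smul_zero g
      neg_mem' := fun {a} ha g hg ↦ by rw [smul_neg, ha g hg] }
  have hBC : B ≤ C := fun m hm ↦
    mem_of_fixed_inf_kerSubgroup_of_neg κ D hD hcont htor hodd C hτD hτC hτ hm
  rcases le_or_finite_of_card_layer_le C B hBC htor hfin hC1 with hCB | hBfin
  · obtain ⟨g, hg, c, hc, hne⟩ := hmove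
    exact absurd (hCB hc g hg) hne
  · exact hBfin

end Generic

/-! ## §3. The curve: `E(K_{∞,w})[p^∞]` lies in the line; Fin_v from one moving element -/

section Curve

variable (E : WeierstrassCurve K) (𝔭 : HeightOneSpectrum (𝓞 K))

/-- **`E(K_{∞,w})[p^∞] ⊆ C` for every `D_𝔭`-stable line `C ≤ E(K̄)[p^∞]` modulo which some element of
`D_𝔭` acts as `−1`** (`p` odd, any `ℤ_p`-extension `κ`, `D_𝔭 = decomp 𝔭` the decomposition group of the
chosen prime above `𝔭`): every point of `E(K̄)[p^∞]` fixed by `D_𝔭 ⊓ ker κ` lies in `C`.  At a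
semistable-twist prime of the door (`E = E♭ ⊗ ψ`, `ψ` ramified quadratic, `E♭` good ordinary or
multiplicative at `p`) take `C = ψ ⊗ Ê♭[p^∞]` resp. `ψ ⊗` (Tate line) and `τ` inertial with `ψ(τ) = −1`.
[cite: JetchevSkinnerWan2017, §3.3 Prop. 3.3.4 Case 3(b) (arXiv:1512.06894 p. 13)] -/
theorem _root_.WeierstrassCurve.geomPrimaryTorsion_fixed_le_line [E.IsElliptic] (hodd : p ≠ 2)
    (C : AddSubgroup (E.geomPrimaryTorsion p)) {τ : absoluteGaloisGroup K} (hτD : τ ∈ decomp 𝔭)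
    (hτC : ∀ c ∈ C, τ • c ∈ C) (hτ : ∀ m : E.geomPrimaryTorsion p, τ • m + m ∈ C)
    {m : E.geomPrimaryTorsion p}
    (hm : m ∈ FixedPoints.addSubgroup ↥(decomp 𝔭 ⊓ κ.kerSubgroup) (E.geomPrimaryTorsion p)) :
    m ∈ C := by
  refine mem_of_fixed_inf_kerSubgroup_of_neg κ (decomp 𝔭) (AcSelmer.isClosed_decomp 𝔭)
    (E.continuous_smul_geomPrimaryTorsion p)
    (fun x ↦ by
      obtain ⟨k, hk⟩ := x.2
      exact ⟨k, Subtype.ext (by rw [AddSubgroupClass.coe_nsmul, hk]; rfl)⟩)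
    hodd C hτD hτC hτ ?_
  intro g hg
  exact (FixedPoints.mem_addSubgroup _ _ m).mp hm ⟨g, hg⟩

/-- **Dichotomy at the curve level.**  With `C`, `τ` as in `geomPrimaryTorsion_fixed_le_line` and
`#C[p] ≤ p`: either `D_𝔭 ⊓ ker κ` fixes `C` pointwise, or Fin_v holds at `(E, p, κ, 𝔭)`
(`SchneiderFreeControlAtoms.LocalTowerTorsionFiniteAt`, the unfolded form of the crux at one frame).
[cite: GreenbergLNM1716, §3 Lemma 3.3 (p. 87)] -/
theorem _root_.WeierstrassCurve.line_le_fixed_or_localTowerTorsionFiniteAt [E.IsElliptic] (hodd : p ≠ 2)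
    (C : AddSubgroup (E.geomPrimaryTorsion p)) {τ : absoluteGaloisGroup K} (hτD : τ ∈ decomp 𝔭)
    (hτC : ∀ c ∈ C, τ • c ∈ C) (hτ : ∀ m : E.geomPrimaryTorsion p, τ • m + m ∈ C)
    (hC1 : Set.ncard {c : E.geomPrimaryTorsion p | c ∈ C ∧ p • c = 0} ≤ p) :
    C ≤ FixedPoints.addSubgroup ↥(decomp 𝔭 ⊓ κ.kerSubgroup) (E.geomPrimaryTorsion p) ∨
      SchneiderFreeControlAtoms.LocalTowerTorsionFiniteAt E p κ 𝔭 := by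
  have htor : ∀ x : E.geomPrimaryTorsion p, ∃ k : ℕ, p ^ k • x = 0 := fun x ↦ by
    obtain ⟨k, hk⟩ := x.2
    exact ⟨k, Subtype.ext (by rw [AddSubgroupClass.coe_nsmul, hk]; rfl)⟩
  have hBC : FixedPoints.addSubgroup ↥(decomp 𝔭 ⊓ κ.kerSubgroup) (E.geomPrimaryTorsion p) ≤ C :=
    fun m hm ↦ E.geomPrimaryTorsion_fixed_le_line κ 𝔭 hodd C hτD hτC hτ hm
  rcases le_or_finite_of_card_layer_le C _ hBC htor
      (AcSelmer.finite_setOf_geomPrimaryTorsion_pow_smul_eq_zero E hp.out.ne_zero) hC1 with h | h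
  · exact Or.inl h
  · exact Or.inr h

/-- **Fin_v from one moving element of the local tower group.**  With `C`, `τ` as in
`geomPrimaryTorsion_fixed_le_line` and `#C[p] ≤ p`: if some `g ∈ D_𝔭 ⊓ ker κ` moves some point of `C`,
then `E(K̄)[p^∞]^{D_𝔭 ⊓ ker κ}` is finite — Fin_v at `(E, p, κ, 𝔭)` in the route's currency
(`SchneiderFreeControlAtoms.LocalTowerTorsionFiniteAt`).  The hypothesis `hmove` is the residual input of
crux `LocalTowerTorsionFiniteX3` on the door's cells: "the canonical character `ψ·ε·unr(α)⁻¹` of `C₀` does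
not kill the local group of the anticyclotomic tower".
[cite: JetchevSkinnerWan2017, §3.3 Prop. 3.3.4 Case 3(b) (arXiv:1512.06894 p. 13)] -/
theorem _root_.WeierstrassCurve.localTowerTorsionFiniteAt_of_line [E.IsElliptic] (hodd : p ≠ 2)
    (C : AddSubgroup (E.geomPrimaryTorsion p)) {τ : absoluteGaloisGroup K} (hτD : τ ∈ decomp 𝔭)
    (hτC : ∀ c ∈ C, τ • c ∈ C) (hτ : ∀ m : E.geomPrimaryTorsion p, τ • m + m ∈ C)
    (hC1 : Set.ncard {c : E.geomPrimaryTorsion p | c ∈ C ∧ p • c = 0} ≤ p)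
    (hmove : ∃ g ∈ decomp 𝔭 ⊓ κ.kerSubgroup, ∃ c ∈ C, g • c ≠ c) :
    SchneiderFreeControlAtoms.LocalTowerTorsionFiniteAt E p κ 𝔭 := by
  rcases E.line_le_fixed_or_localTowerTorsionFiniteAt κ 𝔭 hodd C hτD hτC hτ hC1 with h | h
  · obtain ⟨g, hg, c, hc, hne⟩ := hmove
    exact absurd ((FixedPoints.mem_addSubgroup _ _ c).mp (h hc) ⟨g, hg⟩) hne
  · exact h

end Curve

end Summit.BirchSwinnertonDyer.BirchSwinnertonDyer.Theorems.SchneiderFreeAdditiveX3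

end
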